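import Mathlib
import HarnessLib
import HarnessLib.Audit
import Summits.ValiantsHypothesis.ValiantsHypothesis.Theorems.LacunarySymmetroidMatrixDescartesMultiplierQuotient
import Summits.ValiantsHypothesis.ValiantsHypothesis.Theorems.LacunarySymmetroidMatrixDescartesSmallRatioLemmas

/-!
# ValiantsHypothesis / LacunarySymmetroid — crux `MatrixDescartes` (stmt-ValiantsHypothesis-18050, V1), LINE (A) «product_plus_one»:
# THEOREM D `SmallRatioAtMostTwo` (pen val-idea-25 g9 NOTE §56.18 ≡ crit-1 #422, «exact on paper»; Sketch-T3-s59 rev 7 typed statement)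

For support ratio `c ≤ 2a`, one W row `−α + κX^a + γX^c` (`α, γ > 0 ≤ κ`) times ANY block of `k` zero-change rows
`p_i + q_iX^a + s_iX^c` (`p_i > 0`, `q_i, s_i ≥ 0`) has AT MOST TWO positive critical points — `smallRatioAtMostTwo` is the pen's
typed statement VERBATIM.  (Floor currency: one `(+,−,−)`-type row with any company of one-signed rows, ratio `≤ 2`, every `m`.)

PROOF = ✓ engine `posCrit_le_two_of_rateJ_zero_once` (`…MultiplierQuotient`) + «the rate function `J = V/ψ_B − ψ_B − G₂/G` vanishes at
most once»: at a zero `t₀` of `J` one has EXACTLY `t₀·ψ_B·θJ(t₀) = K`, where `K = −3Σw_i(e_i+ψ) − Σe_i(e_i−a)(e_i−c) + (c+ψ)ψ(a+ψ)` is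
the pen's cumulant expression (`e_i` = row rates, `w_i` = row variances, `ψ = Σe_i`; the support identity `X(X−a)(X−c) = 0` turns third
moments into second ones, and `θ(G₂/G) = (G₂/G − a)(c − G₂/G)` is the two-point variance), and `K < 0` for `c ≤ 2a` is the pen's
Lean-checked algebraic core (`KNegCore.lean`; ✓ `K_neg_of_ratio_le_two` of `…SmallRatioLemmas`, homogenised); so every zero of `J` is a strict down-crossing,
and a differentiable function whose zeros are all strict down-crossings has at most one zero (✓ `zero_once_of_deriv_neg` of `…SmallRatioLemmas`).

HONEST FRAMING: exact free-standing cell (helper); NOT T3♯ (`≤ 3` at every ratio) / the floor law; no stub of LINE (A) is touched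
(A40 unchanged, sorries 4 → 4); `OneChangeFloorK3`, `MatrixDescartes` OPEN; `VP ≠ VNP` is NOT proved and nothing here bears on it.
No definitions, no named facts, no sorry.
-/

set_option linter.dupNamespace false

namespace Summit.ValiantsHypothesis.ValiantsHypothesis.Theorems.LacunarySymmetroidMatrixDescartes

namespace ZeroChange

open Polynomial Finset Set Filter Topology

/-- **THEOREM D (NOTE §56.18 / crit-1 #422) — the pen g9 Sketch-T3-s59 `SmallRatioAtMostTwo`, VERBATIM**: for `c ≤ 2a`, one W row
`(−α, κ, γ)` times any block of `k` zero-change rows has at most TWO positive critical points. -/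
theorem smallRatioAtMostTwo : ∀ (k a c : ℕ), 0 < a → a < c → c ≤ 2 * a → ∀ (α κ γ : ℝ) (p q s : Fin k → ℝ),
    0 < α → 0 ≤ κ → 0 < γ → (∀ i, 0 < p i ∧ 0 ≤ q i ∧ 0 ≤ s i) →
    posCrit (row a c (-α) κ γ * ∏ i, row a c (p i) (q i) (s i)) ≤ 2 := by
  intro k a c ha hac hca α κ γ p q s hα hκ hγ h
  classical
  have hc : 0 < c := ha.trans hac
  have ha' : (0 : ℝ) < a := by exact_mod_cast ha
  have hc' : (0 : ℝ) < c := by exact_mod_cast hc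
  have hac' : (a : ℝ) < c := by exact_mod_cast hac
  have hca' : (c : ℝ) ≤ 2 * a := by exact_mod_cast hca
  refine posCrit_le_two_of_rateJ_zero_once k a c ha hac α κ γ p q s hκ hγ
    (fun i => ⟨(h i).1.le, (h i).2.1, (h i).2.2, by linarith [(h i).1, (h i).2.1, (h i).2.2]⟩) ?_
  intro ξ ξ' hξ hξξ' hJξ
  -- the real functions
  obtain ⟨P, hP⟩ : ∃ P : Fin k → ℝ → ℝ, ∀ i t, P i t = p i + q i * t ^ a + s i * t ^ c := ⟨_, fun _ _ => rfl⟩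
  obtain ⟨N, hN⟩ : ∃ N : Fin k → ℝ → ℝ, ∀ i t, N i t = (a : ℝ) * q i * t ^ a + (c : ℝ) * s i * t ^ c :=
    ⟨_, fun _ _ => rfl⟩
  obtain ⟨M, hM⟩ : ∃ M : Fin k → ℝ → ℝ, ∀ i t, M i t = (a : ℝ) ^ 2 * q i * t ^ a + (c : ℝ) ^ 2 * s i * t ^ c :=
    ⟨_, fun _ _ => rfl⟩
  obtain ⟨L, hL⟩ : ∃ L : Fin k → ℝ → ℝ, ∀ i t, L i t = (a : ℝ) ^ 3 * q i * t ^ a + (c : ℝ) ^ 3 * s i * t ^ c :=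
    ⟨_, fun _ _ => rfl⟩
  obtain ⟨ψ, hψ⟩ : ∃ ψ : Fin k → ℝ → ℝ, ∀ i t, ψ i t = N i t / P i t := ⟨_, fun _ _ => rfl⟩
  obtain ⟨ψB, hψB⟩ : ∃ ψB : ℝ → ℝ, ∀ t, ψB t = ∑ i, ψ i t := ⟨_, fun _ => rfl⟩
  obtain ⟨V, hV⟩ : ∃ V : ℝ → ℝ, ∀ t, V t = ∑ i, (M i t / P i t - ψ i t ^ 2) := ⟨_, fun _ => rfl⟩
  obtain ⟨V₃, hV₃⟩ : ∃ V₃ : ℝ → ℝ, ∀ t, V₃ t = ∑ i, (L i t / P i t - M i t * N i t / P i t ^ 2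
      - 2 * (N i t / P i t) * (M i t / P i t - (N i t / P i t) ^ 2)) := ⟨_, fun _ => rfl⟩
  obtain ⟨G, hG⟩ : ∃ G : ℝ → ℝ, ∀ t, G t = (a : ℝ) * κ * t ^ a + (c : ℝ) * γ * t ^ c := ⟨_, fun _ => rfl⟩
  obtain ⟨G₂, hG₂⟩ : ∃ G₂ : ℝ → ℝ, ∀ t, G₂ t = (a : ℝ) ^ 2 * κ * t ^ a + (c : ℝ) ^ 2 * γ * t ^ c :=
    ⟨_, fun _ => rfl⟩
  obtain ⟨G₃, hG₃⟩ : ∃ G₃ : ℝ → ℝ, ∀ t, G₃ t = (a : ℝ) ^ 3 * κ * t ^ a + (c : ℝ) ^ 3 * γ * t ^ c :=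
    ⟨_, fun _ => rfl⟩
  obtain ⟨J, hJ⟩ : ∃ J : ℝ → ℝ, ∀ t, J t = V t / ψB t - ψB t - G₂ t / G t := ⟨_, fun _ => rfl⟩
  obtain ⟨J', hJ'⟩ : ∃ J' : ℝ → ℝ, ∀ t, J' t = ((V₃ t * ψB t - V t * V t) / ψB t ^ 2 - V t
      - (G₃ t * G t - G₂ t * G₂ t) / G t ^ 2) / t := ⟨_, fun _ => rfl⟩
  have hJfun : ∀ t, J t =
      (∑ i, (((a : ℝ) ^ 2 * q i * t ^ a + (c : ℝ) ^ 2 * s i * t ^ c) / (p i + q i * t ^ a + s i * t ^ c)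
          - (((a : ℝ) * q i * t ^ a + (c : ℝ) * s i * t ^ c) / (p i + q i * t ^ a + s i * t ^ c)) ^ 2)) /
        (∑ i, ((a : ℝ) * q i * t ^ a + (c : ℝ) * s i * t ^ c) / (p i + q i * t ^ a + s i * t ^ c))
      - (∑ i, ((a : ℝ) * q i * t ^ a + (c : ℝ) * s i * t ^ c) / (p i + q i * t ^ a + s i * t ^ c))
      - ((a : ℝ) ^ 2 * κ * t ^ a + (c : ℝ) ^ 2 * γ * t ^ c) / ((a : ℝ) * κ * t ^ a + (c : ℝ) * γ * t ^ c) := by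
    intro t
    rw [hJ, hV, hψB, hG₂, hG]
    simp only [hψ, hM, hN, hP]
  have hJξ' : J ξ = 0 := by rw [hJfun]; exact hJξ
  rw [← hJfun ξ']
  -- elementary facts
  have hPpos : ∀ i t, 0 < t → 0 < P i t := fun i t ht => by
    rw [hP]
    have := (h i).1
    have : 0 ≤ q i * t ^ a := mul_nonneg (h i).2.1 (pow_pos ht a).le
    have : 0 ≤ s i * t ^ c := mul_nonneg (h i).2.2 (pow_pos ht c).le
    linarith
  have hGpos : ∀ t, 0 < t → 0 < G t := fun t ht => by
    rw [hG]; exact add_pos_of_nonneg_of_pos (by positivity) (by positivity)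
  have hNnn : ∀ i t, 0 < t → 0 ≤ N i t := fun i t ht => by
    rw [hN]
    exact add_nonneg (mul_nonneg (mul_nonneg ha'.le (h i).2.1) (pow_pos ht a).le)
      (mul_nonneg (mul_nonneg hc'.le (h i).2.2) (pow_pos ht c).le)
  have hψnn : ∀ i t, 0 < t → 0 ≤ ψ i t := fun i t ht => by
    rw [hψ]; exact div_nonneg (hNnn i t ht) (hPpos i t ht).le
  have hψBnn : ∀ t, 0 < t → 0 ≤ ψB t := fun t ht => by
    rw [hψB]; exact sum_nonneg fun i _ => hψnn i t ht
  have hAgt : ∀ t, 0 < t → (a : ℝ) < G₂ t / G t := fun t ht => by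
    rw [lt_div_iff₀ (hGpos t ht), hG₂, hG]
    have : 0 < (c : ℝ) * γ * t ^ c * ((c : ℝ) - a) := by
      have := sub_pos.2 hac'
      positivity
    nlinarith [mul_nonneg (mul_nonneg ha'.le hκ) (pow_pos ht a).le]
  -- `ψ_B > 0` everywhere (from `J ξ = 0`: with `ψ_B ξ = 0` one would have `J ξ = −G₂/G < 0`)
  have hψBξ : 0 < ψB ξ := by
    rcases (hψBnn ξ hξ).eq_or_lt with h0 | h0
    · exfalso
      rw [hJ, ← h0, div_zero] at hJξ'
      linarith [hAgt ξ hξ]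
    · exact h0
  have hψBpos : ∀ t, 0 < t → 0 < ψB t := by
    obtain ⟨i, -, hi⟩ : ∃ i ∈ (univ : Finset (Fin k)), 0 < ψ i ξ := by
      by_contra hne
      push Not at hne
      have : ψB ξ ≤ 0 := by rw [hψB]; exact sum_nonpos hne
      linarith
    have hqs : 0 < q i ∨ 0 < s i := by
      by_contra hqs
      push Not at hqs
      have hq0 : q i = 0 := le_antisymm hqs.1 (h i).2.1
      have hs0 : s i = 0 := le_antisymm hqs.2 (h i).2.2
      rw [hψ, hN, hq0, hs0] at hi
      simp at hi
    intro t ht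
    have hNi : 0 < N i t := by
      rw [hN]
      rcases hqs with h1 | h1
      · exact add_pos_of_pos_of_nonneg (by positivity) (mul_nonneg (mul_nonneg hc'.le (h i).2.2) (pow_pos ht c).le)
      · exact add_pos_of_nonneg_of_pos (mul_nonneg (mul_nonneg ha'.le (h i).2.1) (pow_pos ht a).le) (by positivity)
    have hψi : 0 < ψ i t := by rw [hψ]; exact div_pos hNi (hPpos i t ht)
    rw [hψB]
    exact lt_of_lt_of_le hψi (single_le_sum (f := fun j => ψ j t) (fun j _ => hψnn j t ht) (mem_univ i))
  -- the derivative of `J` on `(0,∞)`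
  have hJd : ∀ t, 0 < t → HasDerivAt J (J' t) t := by
    intro t ht
    have ht0 : t ≠ 0 := ht.ne'
    have hpowa : (a : ℝ) * t ^ (a - 1) = (a : ℝ) * t ^ a / t := by
      rw [eq_div_iff ht0, mul_assoc, ← pow_succ, Nat.sub_add_cancel (show 1 ≤ a from ha)]
    have hpowc : (c : ℝ) * t ^ (c - 1) = (c : ℝ) * t ^ c / t := by
      rw [eq_div_iff ht0, mul_assoc, ← pow_succ, Nat.sub_add_cancel (show 1 ≤ c from hc)]
    have hrow : ∀ u v w : ℝ, HasDerivAt (fun x => u + v * x ^ a + w * x ^ c)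
        (((a : ℝ) * v * t ^ a + (c : ℝ) * w * t ^ c) / t) t := by
      intro u v w
      refine ((((hasDerivAt_pow a t).const_mul v).const_add u).fun_add
        ((hasDerivAt_pow c t).const_mul w)).congr_deriv ?_
      have e1 : v * ((a : ℝ) * t ^ (a - 1)) = (a : ℝ) * v * t ^ a / t := by rw [hpowa]; ring
      have e2 : w * ((c : ℝ) * t ^ (c - 1)) = (c : ℝ) * w * t ^ c / t := by rw [hpowc]; ring
      rw [e1, e2]; ring
    have hrow0 : ∀ v w : ℝ, HasDerivAt (fun x => v * x ^ a + w * x ^ c)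
        (((a : ℝ) * v * t ^ a + (c : ℝ) * w * t ^ c) / t) t := by
      intro v w
      refine (((hasDerivAt_pow a t).const_mul v).fun_add ((hasDerivAt_pow c t).const_mul w)).congr_deriv ?_
      have e1 : v * ((a : ℝ) * t ^ (a - 1)) = (a : ℝ) * v * t ^ a / t := by rw [hpowa]; ring
      have e2 : w * ((c : ℝ) * t ^ (c - 1)) = (c : ℝ) * w * t ^ c / t := by rw [hpowc]; ring
      rw [e1, e2]; ring
    have hPd : ∀ i, HasDerivAt (P i) (N i t / t) t := by
      intro i
      refine ((hrow (p i) (q i) (s i)).congr_of_eventuallyEq (Filter.Eventually.of_forall (hP i))).congr_deriv ?_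
      rw [hN]
    have hNd : ∀ i, HasDerivAt (N i) (M i t / t) t := by
      intro i
      refine ((hrow0 ((a : ℝ) * q i) ((c : ℝ) * s i)).congr_of_eventuallyEq
        (Filter.Eventually.of_forall (hN i))).congr_deriv ?_
      rw [hM]; ring
    have hMd : ∀ i, HasDerivAt (M i) (L i t / t) t := by
      intro i
      refine ((hrow0 ((a : ℝ) ^ 2 * q i) ((c : ℝ) ^ 2 * s i)).congr_of_eventuallyEq
        (Filter.Eventually.of_forall (hM i))).congr_deriv ?_
      rw [hL]; ring
    have hψd : ∀ i, HasDerivAt (ψ i) ((M i t / P i t - ψ i t ^ 2) / t) t := by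
      intro i
      have h1 := (hNd i).fun_div (hPd i) (hPpos i t ht).ne'
      refine (h1.congr_of_eventuallyEq (Filter.Eventually.of_forall (hψ i))).congr_deriv ?_
      have hP0 : P i t ≠ 0 := (hPpos i t ht).ne'
      rw [hψ]
      field_simp
    have hWd : ∀ i, HasDerivAt (fun x => M i x / P i x - ψ i x ^ 2)
        ((L i t / P i t - M i t * N i t / P i t ^ 2 - 2 * (N i t / P i t) * (M i t / P i t - (N i t / P i t) ^ 2)) / t) t := by
      intro i
      have h1 := ((hMd i).fun_div (hPd i) (hPpos i t ht).ne').fun_sub ((hψd i).fun_mul (hψd i))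
      have e : (fun x => M i x / P i x - ψ i x ^ 2) = fun x => M i x / P i x - ψ i x * ψ i x :=
        funext fun x => by ring
      rw [e]
      refine h1.congr_deriv ?_
      have hP0 : P i t ≠ 0 := (hPpos i t ht).ne'
      rw [hψ]
      field_simp
      ring
    have hVd : HasDerivAt V (V₃ t / t) t := by
      have h1 := HasDerivAt.fun_sum (u := univ) (fun i _ => hWd i)
      refine (h1.congr_of_eventuallyEq (Filter.Eventually.of_forall hV)).congr_deriv ?_
      rw [hV₃, sum_div]
    have hψBd : HasDerivAt ψB (V t / t) t := by
      have h1 : HasDerivAt (fun x => ∑ i, ψ i x) (∑ i, (M i t / P i t - ψ i t ^ 2) / t) t :=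
        HasDerivAt.fun_sum (u := univ) (fun i _ => hψd i)
      refine (h1.congr_of_eventuallyEq (Filter.Eventually.of_forall hψB)).congr_deriv ?_
      rw [hV, sum_div]
    have hGd : HasDerivAt G (G₂ t / t) t := by
      refine ((hrow0 ((a : ℝ) * κ) ((c : ℝ) * γ)).congr_of_eventuallyEq
        (Filter.Eventually.of_forall hG)).congr_deriv ?_
      rw [hG₂]; ring
    have hG₂d : HasDerivAt G₂ (G₃ t / t) t := by
      refine ((hrow0 ((a : ℝ) ^ 2 * κ) ((c : ℝ) ^ 2 * γ)).congr_of_eventuallyEq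
        (Filter.Eventually.of_forall hG₂)).congr_deriv ?_
      rw [hG₃]; ring
    have h1 := ((hVd.fun_div hψBd (hψBpos t ht).ne').fun_sub hψBd).fun_sub (hG₂d.fun_div hGd (hGpos t ht).ne')
    refine (h1.congr_of_eventuallyEq (Filter.Eventually.of_forall hJ)).congr_deriv ?_
    have hB0 : ψB t ≠ 0 := (hψBpos t ht).ne'
    have hG0 : G t ≠ 0 := (hGpos t ht).ne'
    rw [hJ']
    field_simp
  -- at a zero of `J`, `J′ < 0` (the pen's `K < 0`)
  have hJneg : ∀ t, 0 < t → J t = 0 → J' t < 0 := by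
    intro t ht hJt
    have hψpos := hψBpos t ht
    have hG0 : G t ≠ 0 := (hGpos t ht).ne'
    obtain ⟨A, hA⟩ : ∃ A : ℝ, A = G₂ t / G t := ⟨_, rfl⟩
    have hAa : (a : ℝ) < A := by rw [hA]; exact hAgt t ht
    -- rates and variances of the rows at `t`
    obtain ⟨e, he⟩ : ∃ e : Fin k → ℝ, ∀ i, e i = N i t / P i t := ⟨_, fun _ => rfl⟩
    obtain ⟨w, hw⟩ : ∃ w : Fin k → ℝ, ∀ i, w i = M i t / P i t - e i ^ 2 := ⟨_, fun _ => rfl⟩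
    have heψ : ∀ i, ψ i t = e i := fun i => by rw [hψ, he]
    have hψe : ψB t = ∑ i, e i := by rw [hψB]; exact sum_congr rfl fun i _ => heψ i
    have hVw : V t = ∑ i, w i := by rw [hV]; exact sum_congr rfl fun i _ => by rw [hw, heψ]
    have henn : ∀ i, 0 ≤ e i := fun i => by rw [← heψ]; exact hψnn i t ht
    have hwe : ∀ i, e i * ((a : ℝ) - e i) ≤ w i := by
      intro i
      have hP0 : 0 < P i t := hPpos i t ht
      have h1 : (a : ℝ) * e i ≤ M i t / P i t := by
        rw [he, ← mul_div_assoc, div_le_div_iff_of_pos_right hP0, hM, hN]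
        have : (a : ℝ) * ((c : ℝ) * s i * t ^ c) ≤ (c : ℝ) ^ 2 * s i * t ^ c := by
          have h2 : 0 ≤ (c : ℝ) * s i * t ^ c := mul_nonneg (mul_nonneg hc'.le (h i).2.2) (pow_pos ht c).le
          nlinarith
        nlinarith
      rw [hw]; nlinarith
    have hVeq : V t = ψB t * (ψB t + A) := by
      rw [hJ, ← hA] at hJt
      field_simp at hJt
      linarith
    have hΩ : (∑ i, e i) * ((a : ℝ) + ∑ i, e i) < ∑ i, w i := by
      rw [← hψe, ← hVw, hVeq]
      nlinarith [mul_pos hψpos (sub_pos.2 hAa)]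
    have hK := K_neg_of_ratio_le_two (a : ℝ) c hca' e w henn hwe (by rwa [← hψe]) hΩ
    -- the support identity `X(X−a)(X−c) = 0`: third moments from second ones
    have hLMN : ∀ i, L i t = ((a : ℝ) + c) * M i t - (a : ℝ) * c * N i t := fun i => by
      rw [hL, hM, hN]; ring
    have hV₃e : V₃ t = ((a : ℝ) + c) * (∑ i, w i) - 3 * (∑ i, w i * e i) + ((a : ℝ) + c) * (∑ i, e i ^ 2)
        - (a : ℝ) * c * (∑ i, e i) - ∑ i, e i ^ 3 := by
      rw [hV₃, mul_sum, mul_sum, mul_sum, mul_sum, ← sum_sub_distrib, ← sum_add_distrib, ← sum_sub_distrib,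
        ← sum_sub_distrib]
      refine sum_congr rfl fun i _ => ?_
      have hP0 : P i t ≠ 0 := (hPpos i t ht).ne'
      rw [hw, he, hLMN]
      field_simp
      ring
    have hVarA : (G₃ t * G t - G₂ t * G₂ t) / G t ^ 2 = (A - a) * ((c : ℝ) - A) := by
      rw [hA, div_eq_iff (pow_ne_zero 2 hG0)]
      field_simp
      rw [hG₃, hG₂, hG]
      ring
    have h1' : ∑ i, w i * (e i + ∑ j, e j) = ∑ i, w i * e i + (∑ j, e j) * ∑ i, w i := by
      rw [Finset.mul_sum, ← Finset.sum_add_distrib]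
      exact Finset.sum_congr rfl fun i _ => by ring
    have h2' : ∑ i, e i * (e i - a) * (e i - c)
        = ∑ i, e i ^ 3 - ((a : ℝ) + c) * ∑ i, e i ^ 2 + (a : ℝ) * c * ∑ i, e i := by
      rw [Finset.mul_sum, Finset.mul_sum, ← Finset.sum_sub_distrib, ← Finset.sum_add_distrib]
      exact Finset.sum_congr rfl fun i _ => by ring
    rw [h1', h2'] at hK
    have htJ : t * J' t = (V₃ t * ψB t - V t * V t) / ψB t ^ 2 - V t - (G₃ t * G t - G₂ t * G₂ t) / G t ^ 2 := by
      rw [hJ']; field_simp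
    have hid : ψB t * (t * J' t) =
        -3 * (∑ i, w i * e i + (∑ j, e j) * ∑ i, w i)
          - (∑ i, e i ^ 3 - ((a : ℝ) + c) * ∑ i, e i ^ 2 + (a : ℝ) * c * ∑ i, e i)
          + (c + ∑ i, e i) * (∑ i, e i) * (a + ∑ i, e i) := by
      rw [htJ, hVarA, hV₃e, ← hVw, ← hψe, hVeq]
      field_simp
      ring
    have hprod : ψB t * (t * J' t) < 0 := by rw [hid]; exact hK
    by_contra hge
    push Not at hge
    have : 0 ≤ ψB t * (t * J' t) := mul_nonneg hψpos.le (mul_nonneg ht.le hge)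
    linarith
  exact zero_once_of_deriv_neg hJd hJneg hξ hξξ' hJξ'

end ZeroChange

end Summit.ValiantsHypothesis.ValiantsHypothesis.Theorems.LacunarySymmetroidMatrixDescartes
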